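import Mathlib

/-!
# `MatrixDescartes` census — rank-one `(2,4)₁`, chamber (B): the EXPONENT side of the covering theorem, Region I
# (the kill-seven distance-product constants of the kernel certificates (P), (P′), (S), bounded on the first cone)

HONEST FRAMING.  Object-search cell `pub-symmetroid`, seat `val-sym-mdr-p1` (generation 15); helper file `--supports` the crux item
stmt-ValiantsHypothesis-18050 (`Theses.LacunarySymmetroid.MatrixDescartes`, OPEN, on HOLD) with NO closure claim.  Pure real-inequality
lemmas (no pencils, no roots); they are consumed by `…PivotRankOneFourCover` (the covering theorem for chamber (B)).  Nothing here bears on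
`MatrixDescartes` in its window, on `DoorA26` / `DoorA34`, registers / credences, or `VP ≠ VNP`.

WHAT.  The five weight-free kill-seven certificates of the kernel for the eleven-nomial of a rank-one `(2,4)₁` pencil in the interleaving
chamber (B) `d₀ < d₁ < e < d₂ < d₃`, `d₀+d₂ < e+d₁`, `d₁+d₂ < 2e < d₀+d₃ < e+d₂` — (S) `…PivotRankOneFourKillSeven`, (S′) `…KillSevenPrime`,
(P) `…KillSevenPairs`, (P′) `…KillSevenInner`, (T) `…KillSevenBottom` — each read `ρ_X · R_X(directions) ≤ 1`, where the EXPONENT CONSTANT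
`ρ_X = Π_BΠ_C / (Π_AΠ_D)` is a ratio of products of distances between the kept and the killed degrees.  This file and its companion `…CoverBoundsII` bound the constants on
the two halves of chamber (B) cut by the hyperplane `4(e − d₁) = (e − d₀) + 2(d₂ − e)`:
* REGION I (`5e + d₀ ≤ 4d₁ + 2d₂`): `ρ_P ≤ 1/16` (`bound_P`), `ρ_P′ ≤ 1/4` (`bound_Pp`), and `ρ_S ≤ 1/500` (`bound_S_I`, used only on the
  parallel-letter locus `v₁ ∥ v₃`);
* REGION II (`4d₁ + 2d₂ ≤ 5e + d₀`): `ρ_S ≤ 1/5000` (`bound_S`), `ρ_S′ ≤ 3/25` (`bound_Sp`), `ρ_S′·ρ_T ≤ 1/16` (`bound_SpT`; `ρ_T` alone is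
  unbounded at the face `2e = d₀ + d₃`, where `ρ_S′` vanishes).
Each bound is stated in the LITERAL product syntax of the kernel theorem it feeds (hypothesis `hS` there), over real exponents.

PROOF.  Each region is a simplicial cone; in cone coordinates (`x₂ = 2e−d₁−d₂, x₃ = 4d₁+2d₂−5e−d₀, x₄ = d₀+d₃−2e, x₅ = e+d₂−d₀−d₃` on
Region I; `y₀ = (e+d₁−d₀−d₂)/3, y₁ = (5e+d₀−4d₁−2d₂)/3, x₄, x₅` on Region II) every distance factor is a non-negative integer combination
of the coordinates, and after cancelling common factors the polynomial `D − c·N` has NON-NEGATIVE COEFFICIENTS (`core_*`: `ring_nf` +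
`positivity`; found by exact rational arithmetic, seat folder exp/regions.py); the uncancelled products are recovered by
associativity/commutativity.  For `ρ_S′ρ_T` the 13 + 13 surviving factors are split into three groups (`core_SpT1–3`, constants
`1/4 · 1/4 · 1`).

[folklore] Elementary polynomial inequalities; no source.  No definitions, no named facts.
-/

-- `Summit.ValiantsHypothesis.ValiantsHypothesis.…` repeats a component by the D-0017 layout
-- (single-conjunct summit), which the `dupNamespace` linter flags; the name is mandated.
set_option linter.dupNamespace false

namespace Summit.ValiantsHypothesis.ValiantsHypothesis.Theorems.LacunarySymmetroidMatrixDescartes.Pivot.RankOneCover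

set_option maxRecDepth 30000 in
/-- Coefficientwise-dominance certificate (cone coordinates of Region I): `16 · N ≤ D`. -/
theorem core_P (x₂ x₃ x₄ x₅ : ℝ) (h₂ : 0 ≤ x₂) (h₃ : 0 ≤ x₃) (h₄ : 0 ≤ x₄) (h₅ : 0 ≤ x₅) :
    16 * ((3 * x₂ + x₃ + 2 * x₄ + 2 * x₅) * (3 * x₂ + x₃ + x₄ + x₅) * (x₂) * (5 * x₂ + x₃ + 3 * x₄ + 2 * x₅) * (4 * x₂ + x₃ + 2 * x₄ + x₅) * (x₂ + 2 * x₄ + x₅) * (4 * x₂ + x₃ + 2 * x₄ + x₅) * (x₄) * (x₅) * (3 * x₂ + x₃ + x₄ + x₅))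
      ≤ (5 * x₂ + x₃ + 3 * x₄ + 3 * x₅) * (5 * x₂ + x₃ + 4 * x₄ + 4 * x₅) * (9 * x₂ + 2 * x₃ + 6 * x₄ + 5 * x₅) * (x₂ + 2 * x₄ + 2 * x₅) * (8 * x₂ + 2 * x₃ + 5 * x₄ + 4 * x₅) * (4 * x₂ + x₃ + 4 * x₄ + 3 * x₅) * (8 * x₂ + 2 * x₃ + 6 * x₄ + 5 * x₅) * (5 * x₂ + x₃ + 5 * x₄ + 4 * x₅) * (8 * x₂ + 2 * x₃ + 5 * x₄ + 4 * x₅) * (x₂ + 2 * x₄ + 2 * x₅) := by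
  rw [← sub_nonneg]
  ring_nf
  positivity

/-- **Exponent bound for certificate (P) on Region I of chamber (B)**: `16 · Π_BΠ_C ≤ Π_AΠ_D` for the kill-seven distance
products of the kernel theorem (literal syntax), with the positivity facts used downstream. -/
theorem bound_P (e d₀ d₁ d₂ d₃ : ℝ) (hB2 : d₁ + d₂ < 2 * e) (hB3 : 2 * e < d₀ + d₃) (hB4 : d₀ + d₃ < e + d₂)
    (hI : 5 * e + d₀ ≤ 4 * d₁ + 2 * d₂) :
    16 * ((((d₁ : ℝ) + d₂ - e - d₀) * ((d₂ : ℝ) - e) * ((d₁ : ℝ) - d₀) * ((2 : ℝ) * e - d₁ - d₂) * ((e : ℝ) - d₁) * ((e : ℝ) + d₃ - d₁ - d₂) * ((d₃ : ℝ) - d₂))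
      * (((d₃ : ℝ) - e) * ((d₀ : ℝ) + d₃ - e - d₁) * ((d₃ : ℝ) - d₂) * ((d₀ : ℝ) + d₃ - 2 * e) * ((e : ℝ) + d₂ - d₀ - d₃) * ((d₁ : ℝ) - d₀) * ((e : ℝ) - d₀)))
      ≤ (((2 : ℝ) * e - d₀ - d₁) * ((e : ℝ) - d₁) * ((e : ℝ) - d₀) * ((e : ℝ) + d₂ - d₀ - d₁) * ((e : ℝ) + d₃ - d₀ - d₁) * ((d₂ : ℝ) - d₁) * ((d₃ : ℝ) - d₀))
      * (((d₂ : ℝ) + d₃ - 2 * e) * ((d₂ : ℝ) + d₃ - e - d₀) * ((d₂ : ℝ) + d₃ - e - d₁) * ((d₃ : ℝ) - e) * ((d₂ : ℝ) - e) * ((d₃ : ℝ) - d₀) * ((d₂ : ℝ) - d₁))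
    ∧ 0 < (((2 : ℝ) * e - d₀ - d₁) * ((e : ℝ) - d₁) * ((e : ℝ) - d₀) * ((e : ℝ) + d₂ - d₀ - d₁) * ((e : ℝ) + d₃ - d₀ - d₁) * ((d₂ : ℝ) - d₁) * ((d₃ : ℝ) - d₀))
      * (((d₂ : ℝ) + d₃ - 2 * e) * ((d₂ : ℝ) + d₃ - e - d₀) * ((d₂ : ℝ) + d₃ - e - d₁) * ((d₃ : ℝ) - e) * ((d₂ : ℝ) - e) * ((d₃ : ℝ) - d₀) * ((d₂ : ℝ) - d₁))
    ∧ 0 ≤ (((d₁ : ℝ) + d₂ - e - d₀) * ((d₂ : ℝ) - e) * ((d₁ : ℝ) - d₀) * ((2 : ℝ) * e - d₁ - d₂) * ((e : ℝ) - d₁) * ((e : ℝ) + d₃ - d₁ - d₂) * ((d₃ : ℝ) - d₂))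
      * (((d₃ : ℝ) - e) * ((d₀ : ℝ) + d₃ - e - d₁) * ((d₃ : ℝ) - d₂) * ((d₀ : ℝ) + d₃ - 2 * e) * ((e : ℝ) + d₂ - d₀ - d₃) * ((d₁ : ℝ) - d₀) * ((e : ℝ) - d₀)) := by
  obtain ⟨x₂, hx₂⟩ : ∃ x : ℝ, x = 2 * e - d₁ - d₂ := ⟨_, rfl⟩
  obtain ⟨x₃, hx₃⟩ : ∃ x : ℝ, x = 4 * d₁ + 2 * d₂ - 5 * e - d₀ := ⟨_, rfl⟩
  obtain ⟨x₄, hx₄⟩ : ∃ x : ℝ, x = d₀ + d₃ - 2 * e := ⟨_, rfl⟩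
  obtain ⟨x₅, hx₅⟩ : ∃ x : ℝ, x = e + d₂ - d₀ - d₃ := ⟨_, rfl⟩
  have h₂ : 0 ≤ x₂ := by rw [hx₂]; linarith
  have h₃ : 0 ≤ x₃ := by rw [hx₃]; linarith
  have h₂' : 0 < x₂ := by rw [hx₂]; linarith
  have h₄ : 0 ≤ x₄ := by rw [hx₄]; linarith
  have h₅ : 0 ≤ x₅ := by rw [hx₅]; linarith
  have h₄' : 0 < x₄ := by rw [hx₄]; linarith
  have h₅' : 0 < x₅ := by rw [hx₅]; linarith
  have eA : ((2 : ℝ) * e - d₀ - d₁) * ((e : ℝ) - d₁) * ((e : ℝ) - d₀) * ((e : ℝ) + d₂ - d₀ - d₁) * ((e : ℝ) + d₃ - d₀ - d₁) * ((d₂ : ℝ) - d₁) * ((d₃ : ℝ) - d₀)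
      = (5 * x₂ + x₃ + 3 * x₄ + 3 * x₅) * (x₂ + x₄ + x₅) * (4 * x₂ + x₃ + 2 * x₄ + 2 * x₅) * (5 * x₂ + x₃ + 4 * x₄ + 4 * x₅) * (9 * x₂ + 2 * x₃ + 6 * x₄ + 5 * x₅) * (x₂ + 2 * x₄ + 2 * x₅) * (8 * x₂ + 2 * x₃ + 5 * x₄ + 4 * x₅) := by
    rw [hx₂, hx₃, hx₄, hx₅]; ring
  have eB : ((d₁ : ℝ) + d₂ - e - d₀) * ((d₂ : ℝ) - e) * ((d₁ : ℝ) - d₀) * ((2 : ℝ) * e - d₁ - d₂) * ((e : ℝ) - d₁) * ((e : ℝ) + d₃ - d₁ - d₂) * ((d₃ : ℝ) - d₂)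
      = (3 * x₂ + x₃ + 2 * x₄ + 2 * x₅) * (x₄ + x₅) * (3 * x₂ + x₃ + x₄ + x₅) * (x₂) * (x₂ + x₄ + x₅) * (5 * x₂ + x₃ + 3 * x₄ + 2 * x₅) * (4 * x₂ + x₃ + 2 * x₄ + x₅) := by
    rw [hx₂, hx₃, hx₄, hx₅]; ring
  have eC : ((d₃ : ℝ) - e) * ((d₀ : ℝ) + d₃ - e - d₁) * ((d₃ : ℝ) - d₂) * ((d₀ : ℝ) + d₃ - 2 * e) * ((e : ℝ) + d₂ - d₀ - d₃) * ((d₁ : ℝ) - d₀) * ((e : ℝ) - d₀)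
      = (4 * x₂ + x₃ + 3 * x₄ + 2 * x₅) * (x₂ + 2 * x₄ + x₅) * (4 * x₂ + x₃ + 2 * x₄ + x₅) * (x₄) * (x₅) * (3 * x₂ + x₃ + x₄ + x₅) * (4 * x₂ + x₃ + 2 * x₄ + 2 * x₅) := by
    rw [hx₂, hx₃, hx₄, hx₅]; ring
  have eD : ((d₂ : ℝ) + d₃ - 2 * e) * ((d₂ : ℝ) + d₃ - e - d₀) * ((d₂ : ℝ) + d₃ - e - d₁) * ((d₃ : ℝ) - e) * ((d₂ : ℝ) - e) * ((d₃ : ℝ) - d₀) * ((d₂ : ℝ) - d₁)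
      = (4 * x₂ + x₃ + 4 * x₄ + 3 * x₅) * (8 * x₂ + 2 * x₃ + 6 * x₄ + 5 * x₅) * (5 * x₂ + x₃ + 5 * x₄ + 4 * x₅) * (4 * x₂ + x₃ + 3 * x₄ + 2 * x₅) * (x₄ + x₅) * (8 * x₂ + 2 * x₃ + 5 * x₄ + 4 * x₅) * (x₂ + 2 * x₄ + 2 * x₅) := by
    rw [hx₂, hx₃, hx₄, hx₅]; ring
  rw [eA, eB, eC, eD]
  refine ⟨?_, by positivity, by positivity⟩
  have key := core_P x₂ x₃ x₄ x₅ h₂ h₃ h₄ h₅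
  have hQ : (0 : ℝ) ≤ (x₄ + x₅) * (x₂ + x₄ + x₅) * (4 * x₂ + x₃ + 3 * x₄ + 2 * x₅) * (4 * x₂ + x₃ + 2 * x₄ + 2 * x₅) := by positivity
  calc 16 * ((3 * x₂ + x₃ + 2 * x₄ + 2 * x₅) * (x₄ + x₅) * (3 * x₂ + x₃ + x₄ + x₅) * (x₂) * (x₂ + x₄ + x₅) * (5 * x₂ + x₃ + 3 * x₄ + 2 * x₅) * (4 * x₂ + x₃ + 2 * x₄ + x₅)
      * ((4 * x₂ + x₃ + 3 * x₄ + 2 * x₅) * (x₂ + 2 * x₄ + x₅) * (4 * x₂ + x₃ + 2 * x₄ + x₅) * (x₄) * (x₅) * (3 * x₂ + x₃ + x₄ + x₅) * (4 * x₂ + x₃ + 2 * x₄ + 2 * x₅)))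
      = (16 * ((3 * x₂ + x₃ + 2 * x₄ + 2 * x₅) * (3 * x₂ + x₃ + x₄ + x₅) * (x₂) * (5 * x₂ + x₃ + 3 * x₄ + 2 * x₅) * (4 * x₂ + x₃ + 2 * x₄ + x₅) * (x₂ + 2 * x₄ + x₅) * (4 * x₂ + x₃ + 2 * x₄ + x₅) * (x₄) * (x₅) * (3 * x₂ + x₃ + x₄ + x₅)))
        * ((x₄ + x₅) * (x₂ + x₄ + x₅) * (4 * x₂ + x₃ + 3 * x₄ + 2 * x₅) * (4 * x₂ + x₃ + 2 * x₄ + 2 * x₅)) := by ring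
    _ ≤ ((5 * x₂ + x₃ + 3 * x₄ + 3 * x₅) * (5 * x₂ + x₃ + 4 * x₄ + 4 * x₅) * (9 * x₂ + 2 * x₃ + 6 * x₄ + 5 * x₅) * (x₂ + 2 * x₄ + 2 * x₅) * (8 * x₂ + 2 * x₃ + 5 * x₄ + 4 * x₅) * (4 * x₂ + x₃ + 4 * x₄ + 3 * x₅) * (8 * x₂ + 2 * x₃ + 6 * x₄ + 5 * x₅) * (5 * x₂ + x₃ + 5 * x₄ + 4 * x₅) * (8 * x₂ + 2 * x₃ + 5 * x₄ + 4 * x₅) * (x₂ + 2 * x₄ + 2 * x₅))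
        * ((x₄ + x₅) * (x₂ + x₄ + x₅) * (4 * x₂ + x₃ + 3 * x₄ + 2 * x₅) * (4 * x₂ + x₃ + 2 * x₄ + 2 * x₅)) := mul_le_mul_of_nonneg_right key hQ
    _ = (5 * x₂ + x₃ + 3 * x₄ + 3 * x₅) * (x₂ + x₄ + x₅) * (4 * x₂ + x₃ + 2 * x₄ + 2 * x₅) * (5 * x₂ + x₃ + 4 * x₄ + 4 * x₅) * (9 * x₂ + 2 * x₃ + 6 * x₄ + 5 * x₅) * (x₂ + 2 * x₄ + 2 * x₅) * (8 * x₂ + 2 * x₃ + 5 * x₄ + 4 * x₅)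
      * ((4 * x₂ + x₃ + 4 * x₄ + 3 * x₅) * (8 * x₂ + 2 * x₃ + 6 * x₄ + 5 * x₅) * (5 * x₂ + x₃ + 5 * x₄ + 4 * x₅) * (4 * x₂ + x₃ + 3 * x₄ + 2 * x₅) * (x₄ + x₅) * (8 * x₂ + 2 * x₃ + 5 * x₄ + 4 * x₅) * (x₂ + 2 * x₄ + 2 * x₅)) := by ac_rfl

set_option maxRecDepth 30000 in
/-- Coefficientwise-dominance certificate (cone coordinates of Region I): `4 · N ≤ D`. -/
theorem core_Pp (x₂ x₃ x₄ x₅ : ℝ) (h₂ : 0 ≤ x₂) (h₃ : 0 ≤ x₃) (h₄ : 0 ≤ x₄) (h₅ : 0 ≤ x₅) :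
    4 * ((x₂) * (3 * x₂ + x₃ + 2 * x₄ + 2 * x₅) * (5 * x₂ + x₃ + 3 * x₄ + 2 * x₅) * (4 * x₂ + x₃ + 3 * x₄ + 3 * x₅) * (5 * x₂ + x₃ + 4 * x₄ + 3 * x₅) * (x₄) * (x₂ + 2 * x₄ + x₅) * (x₅) * (5 * x₂ + x₃ + 4 * x₄ + 3 * x₅) * (4 * x₂ + x₃ + 3 * x₄ + 3 * x₅))
      ≤ (4 * x₂ + x₃ + x₄ + x₅) * (3 * x₂ + x₃) * (8 * x₂ + 2 * x₃ + 4 * x₄ + 3 * x₅) * (x₂ + 2 * x₄ + 2 * x₅) * (8 * x₂ + 2 * x₃ + 5 * x₄ + 4 * x₅) * (3 * x₂ + x₃ + 2 * x₄ + x₅) * (7 * x₂ + 2 * x₃ + 4 * x₄ + 3 * x₅) * (3 * x₂ + x₃ + x₄) * (8 * x₂ + 2 * x₃ + 5 * x₄ + 4 * x₅) * (x₂ + 2 * x₄ + 2 * x₅) := by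
  rw [← sub_nonneg]
  ring_nf
  positivity

/-- **Exponent bound for certificate (Pp) on Region I of chamber (B)**: `4 · Π_BΠ_C ≤ Π_AΠ_D` for the kill-seven distance
products of the kernel theorem (literal syntax), with the positivity facts used downstream. -/
theorem bound_Pp (e d₀ d₁ d₂ d₃ : ℝ) (hB2 : d₁ + d₂ < 2 * e) (hB3 : 2 * e < d₀ + d₃) (hB4 : d₀ + d₃ < e + d₂)
    (hI : 5 * e + d₀ ≤ 4 * d₁ + 2 * d₂) :
    4 * ((((2 : ℝ) * e - d₁ - d₂) * ((d₁ : ℝ) + d₂ - e - d₀) * ((d₂ : ℝ) - e) * ((e : ℝ) - d₁) * ((e : ℝ) + d₃ - d₁ - d₂) * ((d₂ : ℝ) - d₀) * ((d₃ : ℝ) - d₁))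
      * (((d₀ : ℝ) + d₃ - 2 * e) * ((d₃ : ℝ) - e) * ((d₀ : ℝ) + d₃ - e - d₁) * ((e : ℝ) + d₂ - d₀ - d₃) * ((e : ℝ) - d₀) * ((d₃ : ℝ) - d₁) * ((d₂ : ℝ) - d₀)))
      ≤ (((2 : ℝ) * e - d₀ - d₂) * ((d₂ : ℝ) - e) * ((e : ℝ) + d₁ - d₀ - d₂) * ((e : ℝ) - d₀) * ((e : ℝ) + d₃ - d₀ - d₂) * ((d₂ : ℝ) - d₁) * ((d₃ : ℝ) - d₀))
      * (((d₁ : ℝ) + d₃ - 2 * e) * ((d₁ : ℝ) + d₃ - e - d₀) * ((d₃ : ℝ) - e) * ((d₁ : ℝ) + d₃ - e - d₂) * ((e : ℝ) - d₁) * ((d₃ : ℝ) - d₀) * ((d₂ : ℝ) - d₁))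
    ∧ 0 < (((2 : ℝ) * e - d₀ - d₂) * ((d₂ : ℝ) - e) * ((e : ℝ) + d₁ - d₀ - d₂) * ((e : ℝ) - d₀) * ((e : ℝ) + d₃ - d₀ - d₂) * ((d₂ : ℝ) - d₁) * ((d₃ : ℝ) - d₀))
      * (((d₁ : ℝ) + d₃ - 2 * e) * ((d₁ : ℝ) + d₃ - e - d₀) * ((d₃ : ℝ) - e) * ((d₁ : ℝ) + d₃ - e - d₂) * ((e : ℝ) - d₁) * ((d₃ : ℝ) - d₀) * ((d₂ : ℝ) - d₁))
    ∧ 0 ≤ (((2 : ℝ) * e - d₁ - d₂) * ((d₁ : ℝ) + d₂ - e - d₀) * ((d₂ : ℝ) - e) * ((e : ℝ) - d₁) * ((e : ℝ) + d₃ - d₁ - d₂) * ((d₂ : ℝ) - d₀) * ((d₃ : ℝ) - d₁))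
      * (((d₀ : ℝ) + d₃ - 2 * e) * ((d₃ : ℝ) - e) * ((d₀ : ℝ) + d₃ - e - d₁) * ((e : ℝ) + d₂ - d₀ - d₃) * ((e : ℝ) - d₀) * ((d₃ : ℝ) - d₁) * ((d₂ : ℝ) - d₀)) := by
  obtain ⟨x₂, hx₂⟩ : ∃ x : ℝ, x = 2 * e - d₁ - d₂ := ⟨_, rfl⟩
  obtain ⟨x₃, hx₃⟩ : ∃ x : ℝ, x = 4 * d₁ + 2 * d₂ - 5 * e - d₀ := ⟨_, rfl⟩
  obtain ⟨x₄, hx₄⟩ : ∃ x : ℝ, x = d₀ + d₃ - 2 * e := ⟨_, rfl⟩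
  obtain ⟨x₅, hx₅⟩ : ∃ x : ℝ, x = e + d₂ - d₀ - d₃ := ⟨_, rfl⟩
  have h₂ : 0 ≤ x₂ := by rw [hx₂]; linarith
  have h₃ : 0 ≤ x₃ := by rw [hx₃]; linarith
  have h₂' : 0 < x₂ := by rw [hx₂]; linarith
  have h₄ : 0 ≤ x₄ := by rw [hx₄]; linarith
  have h₅ : 0 ≤ x₅ := by rw [hx₅]; linarith
  have h₄' : 0 < x₄ := by rw [hx₄]; linarith
  have h₅' : 0 < x₅ := by rw [hx₅]; linarith
  have eA : ((2 : ℝ) * e - d₀ - d₂) * ((d₂ : ℝ) - e) * ((e : ℝ) + d₁ - d₀ - d₂) * ((e : ℝ) - d₀) * ((e : ℝ) + d₃ - d₀ - d₂) * ((d₂ : ℝ) - d₁) * ((d₃ : ℝ) - d₀)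
      = (4 * x₂ + x₃ + x₄ + x₅) * (x₄ + x₅) * (3 * x₂ + x₃) * (4 * x₂ + x₃ + 2 * x₄ + 2 * x₅) * (8 * x₂ + 2 * x₃ + 4 * x₄ + 3 * x₅) * (x₂ + 2 * x₄ + 2 * x₅) * (8 * x₂ + 2 * x₃ + 5 * x₄ + 4 * x₅) := by
    rw [hx₂, hx₃, hx₄, hx₅]; ring
  have eB : ((2 : ℝ) * e - d₁ - d₂) * ((d₁ : ℝ) + d₂ - e - d₀) * ((d₂ : ℝ) - e) * ((e : ℝ) - d₁) * ((e : ℝ) + d₃ - d₁ - d₂) * ((d₂ : ℝ) - d₀) * ((d₃ : ℝ) - d₁)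
      = (x₂) * (3 * x₂ + x₃ + 2 * x₄ + 2 * x₅) * (x₄ + x₅) * (x₂ + x₄ + x₅) * (5 * x₂ + x₃ + 3 * x₄ + 2 * x₅) * (4 * x₂ + x₃ + 3 * x₄ + 3 * x₅) * (5 * x₂ + x₃ + 4 * x₄ + 3 * x₅) := by
    rw [hx₂, hx₃, hx₄, hx₅]; ring
  have eC : ((d₀ : ℝ) + d₃ - 2 * e) * ((d₃ : ℝ) - e) * ((d₀ : ℝ) + d₃ - e - d₁) * ((e : ℝ) + d₂ - d₀ - d₃) * ((e : ℝ) - d₀) * ((d₃ : ℝ) - d₁) * ((d₂ : ℝ) - d₀)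
      = (x₄) * (4 * x₂ + x₃ + 3 * x₄ + 2 * x₅) * (x₂ + 2 * x₄ + x₅) * (x₅) * (4 * x₂ + x₃ + 2 * x₄ + 2 * x₅) * (5 * x₂ + x₃ + 4 * x₄ + 3 * x₅) * (4 * x₂ + x₃ + 3 * x₄ + 3 * x₅) := by
    rw [hx₂, hx₃, hx₄, hx₅]; ring
  have eD : ((d₁ : ℝ) + d₃ - 2 * e) * ((d₁ : ℝ) + d₃ - e - d₀) * ((d₃ : ℝ) - e) * ((d₁ : ℝ) + d₃ - e - d₂) * ((e : ℝ) - d₁) * ((d₃ : ℝ) - d₀) * ((d₂ : ℝ) - d₁)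
      = (3 * x₂ + x₃ + 2 * x₄ + x₅) * (7 * x₂ + 2 * x₃ + 4 * x₄ + 3 * x₅) * (4 * x₂ + x₃ + 3 * x₄ + 2 * x₅) * (3 * x₂ + x₃ + x₄) * (x₂ + x₄ + x₅) * (8 * x₂ + 2 * x₃ + 5 * x₄ + 4 * x₅) * (x₂ + 2 * x₄ + 2 * x₅) := by
    rw [hx₂, hx₃, hx₄, hx₅]; ring
  rw [eA, eB, eC, eD]
  refine ⟨?_, by positivity, by positivity⟩
  have key := core_Pp x₂ x₃ x₄ x₅ h₂ h₃ h₄ h₅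
  have hQ : (0 : ℝ) ≤ (x₄ + x₅) * (x₂ + x₄ + x₅) * (4 * x₂ + x₃ + 3 * x₄ + 2 * x₅) * (4 * x₂ + x₃ + 2 * x₄ + 2 * x₅) := by positivity
  calc 4 * ((x₂) * (3 * x₂ + x₃ + 2 * x₄ + 2 * x₅) * (x₄ + x₅) * (x₂ + x₄ + x₅) * (5 * x₂ + x₃ + 3 * x₄ + 2 * x₅) * (4 * x₂ + x₃ + 3 * x₄ + 3 * x₅) * (5 * x₂ + x₃ + 4 * x₄ + 3 * x₅)
      * ((x₄) * (4 * x₂ + x₃ + 3 * x₄ + 2 * x₅) * (x₂ + 2 * x₄ + x₅) * (x₅) * (4 * x₂ + x₃ + 2 * x₄ + 2 * x₅) * (5 * x₂ + x₃ + 4 * x₄ + 3 * x₅) * (4 * x₂ + x₃ + 3 * x₄ + 3 * x₅)))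
      = (4 * ((x₂) * (3 * x₂ + x₃ + 2 * x₄ + 2 * x₅) * (5 * x₂ + x₃ + 3 * x₄ + 2 * x₅) * (4 * x₂ + x₃ + 3 * x₄ + 3 * x₅) * (5 * x₂ + x₃ + 4 * x₄ + 3 * x₅) * (x₄) * (x₂ + 2 * x₄ + x₅) * (x₅) * (5 * x₂ + x₃ + 4 * x₄ + 3 * x₅) * (4 * x₂ + x₃ + 3 * x₄ + 3 * x₅)))
        * ((x₄ + x₅) * (x₂ + x₄ + x₅) * (4 * x₂ + x₃ + 3 * x₄ + 2 * x₅) * (4 * x₂ + x₃ + 2 * x₄ + 2 * x₅)) := by ring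
    _ ≤ ((4 * x₂ + x₃ + x₄ + x₅) * (3 * x₂ + x₃) * (8 * x₂ + 2 * x₃ + 4 * x₄ + 3 * x₅) * (x₂ + 2 * x₄ + 2 * x₅) * (8 * x₂ + 2 * x₃ + 5 * x₄ + 4 * x₅) * (3 * x₂ + x₃ + 2 * x₄ + x₅) * (7 * x₂ + 2 * x₃ + 4 * x₄ + 3 * x₅) * (3 * x₂ + x₃ + x₄) * (8 * x₂ + 2 * x₃ + 5 * x₄ + 4 * x₅) * (x₂ + 2 * x₄ + 2 * x₅))
        * ((x₄ + x₅) * (x₂ + x₄ + x₅) * (4 * x₂ + x₃ + 3 * x₄ + 2 * x₅) * (4 * x₂ + x₃ + 2 * x₄ + 2 * x₅)) := mul_le_mul_of_nonneg_right key hQ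
    _ = (4 * x₂ + x₃ + x₄ + x₅) * (x₄ + x₅) * (3 * x₂ + x₃) * (4 * x₂ + x₃ + 2 * x₄ + 2 * x₅) * (8 * x₂ + 2 * x₃ + 4 * x₄ + 3 * x₅) * (x₂ + 2 * x₄ + 2 * x₅) * (8 * x₂ + 2 * x₃ + 5 * x₄ + 4 * x₅)
      * ((3 * x₂ + x₃ + 2 * x₄ + x₅) * (7 * x₂ + 2 * x₃ + 4 * x₄ + 3 * x₅) * (4 * x₂ + x₃ + 3 * x₄ + 2 * x₅) * (3 * x₂ + x₃ + x₄) * (x₂ + x₄ + x₅) * (8 * x₂ + 2 * x₃ + 5 * x₄ + 4 * x₅) * (x₂ + 2 * x₄ + 2 * x₅)) := by ac_rfl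

set_option maxRecDepth 30000 in
/-- Coefficientwise-dominance certificate (cone coordinates of Region I): `500 · N ≤ D`. -/
theorem core_S_I (x₂ x₃ x₄ x₅ : ℝ) (h₂ : 0 ≤ x₂) (h₃ : 0 ≤ x₃) (h₄ : 0 ≤ x₄) (h₅ : 0 ≤ x₅) :
    500 * ((3 * x₂ + x₃ + x₄ + x₅) * (3 * x₂ + x₃) * (5 * x₂ + x₃ + 5 * x₄ + 4 * x₅) * (4 * x₂ + x₃ + 3 * x₄ + 2 * x₅) * (x₂ + x₄) * (x₄) * (x₅) * (3 * x₂ + x₃ + x₄ + x₅))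
      ≤ (5 * x₂ + x₃ + 3 * x₄ + 3 * x₅) * (5 * x₂ + x₃ + 4 * x₄ + 4 * x₅) * (8 * x₂ + 2 * x₃ + 5 * x₄ + 4 * x₅) * (9 * x₂ + 2 * x₃ + 7 * x₄ + 6 * x₅) * (8 * x₂ + 2 * x₃ + 5 * x₄ + 4 * x₅) * (8 * x₂ + 2 * x₃ + 4 * x₄ + 3 * x₅) * (5 * x₂ + x₃ + 3 * x₄ + 2 * x₅) * (x₂ + x₄ + x₅) := by
  rw [← sub_nonneg]
  ring_nf
  positivity

/-- **Exponent bound for certificate (S) on Region I of chamber (B)**: `500 · Π_BΠ_C ≤ Π_AΠ_D` for the kill-seven distance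
products of the kernel theorem (literal syntax), with the positivity facts used downstream. -/
theorem bound_S_I (e d₀ d₁ d₂ d₃ : ℝ) (hB2 : d₁ + d₂ < 2 * e) (hB3 : 2 * e < d₀ + d₃) (hB4 : d₀ + d₃ < e + d₂)
    (hI : 5 * e + d₀ ≤ 4 * d₁ + 2 * d₂) :
    500 * ((((d₁ : ℝ) - d₀) * ((e : ℝ) + d₁ - d₀ - d₂) * ((d₂ : ℝ) - e) * ((e : ℝ) - d₁) * ((d₂ : ℝ) - d₁) * ((d₃ : ℝ) - e) * ((d₂ : ℝ) + d₃ - e - d₁))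
      * (((d₃ : ℝ) - e) * ((d₃ : ℝ) - d₂) * ((d₀ : ℝ) + d₃ - d₁ - d₂) * ((d₀ : ℝ) + d₃ - 2 * e) * ((e : ℝ) + d₂ - d₀ - d₃) * ((d₁ : ℝ) - d₀) * ((d₂ : ℝ) - d₀)))
      ≤ (((2 : ℝ) * e - d₀ - d₁) * ((e : ℝ) - d₁) * ((e : ℝ) + d₂ - d₀ - d₁) * ((d₂ : ℝ) - d₁) * ((d₂ : ℝ) - d₀) * ((d₃ : ℝ) - d₀) * ((d₂ : ℝ) + d₃ - d₀ - d₁))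
      * (((e : ℝ) + d₃ - e - d₀) * ((d₃ : ℝ) - d₂ + e - d₀) * ((d₃ : ℝ) - d₂ + e - d₁) * ((d₃ : ℝ) - e) * ((d₃ : ℝ) - d₂) * ((e : ℝ) - d₁) * ((d₂ : ℝ) - e))
    ∧ 0 < (((2 : ℝ) * e - d₀ - d₁) * ((e : ℝ) - d₁) * ((e : ℝ) + d₂ - d₀ - d₁) * ((d₂ : ℝ) - d₁) * ((d₂ : ℝ) - d₀) * ((d₃ : ℝ) - d₀) * ((d₂ : ℝ) + d₃ - d₀ - d₁))
      * (((e : ℝ) + d₃ - e - d₀) * ((d₃ : ℝ) - d₂ + e - d₀) * ((d₃ : ℝ) - d₂ + e - d₁) * ((d₃ : ℝ) - e) * ((d₃ : ℝ) - d₂) * ((e : ℝ) - d₁) * ((d₂ : ℝ) - e))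
    ∧ 0 ≤ (((d₁ : ℝ) - d₀) * ((e : ℝ) + d₁ - d₀ - d₂) * ((d₂ : ℝ) - e) * ((e : ℝ) - d₁) * ((d₂ : ℝ) - d₁) * ((d₃ : ℝ) - e) * ((d₂ : ℝ) + d₃ - e - d₁))
      * (((d₃ : ℝ) - e) * ((d₃ : ℝ) - d₂) * ((d₀ : ℝ) + d₃ - d₁ - d₂) * ((d₀ : ℝ) + d₃ - 2 * e) * ((e : ℝ) + d₂ - d₀ - d₃) * ((d₁ : ℝ) - d₀) * ((d₂ : ℝ) - d₀)) := by
  obtain ⟨x₂, hx₂⟩ : ∃ x : ℝ, x = 2 * e - d₁ - d₂ := ⟨_, rfl⟩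
  obtain ⟨x₃, hx₃⟩ : ∃ x : ℝ, x = 4 * d₁ + 2 * d₂ - 5 * e - d₀ := ⟨_, rfl⟩
  obtain ⟨x₄, hx₄⟩ : ∃ x : ℝ, x = d₀ + d₃ - 2 * e := ⟨_, rfl⟩
  obtain ⟨x₅, hx₅⟩ : ∃ x : ℝ, x = e + d₂ - d₀ - d₃ := ⟨_, rfl⟩
  have h₂ : 0 ≤ x₂ := by rw [hx₂]; linarith
  have h₃ : 0 ≤ x₃ := by rw [hx₃]; linarith
  have h₂' : 0 < x₂ := by rw [hx₂]; linarith
  have h₄ : 0 ≤ x₄ := by rw [hx₄]; linarith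
  have h₅ : 0 ≤ x₅ := by rw [hx₅]; linarith
  have h₄' : 0 < x₄ := by rw [hx₄]; linarith
  have h₅' : 0 < x₅ := by rw [hx₅]; linarith
  have eA : ((2 : ℝ) * e - d₀ - d₁) * ((e : ℝ) - d₁) * ((e : ℝ) + d₂ - d₀ - d₁) * ((d₂ : ℝ) - d₁) * ((d₂ : ℝ) - d₀) * ((d₃ : ℝ) - d₀) * ((d₂ : ℝ) + d₃ - d₀ - d₁)
      = (5 * x₂ + x₃ + 3 * x₄ + 3 * x₅) * (x₂ + x₄ + x₅) * (5 * x₂ + x₃ + 4 * x₄ + 4 * x₅) * (x₂ + 2 * x₄ + 2 * x₅) * (4 * x₂ + x₃ + 3 * x₄ + 3 * x₅) * (8 * x₂ + 2 * x₃ + 5 * x₄ + 4 * x₅) * (9 * x₂ + 2 * x₃ + 7 * x₄ + 6 * x₅) := by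
    rw [hx₂, hx₃, hx₄, hx₅]; ring
  have eB : ((d₁ : ℝ) - d₀) * ((e : ℝ) + d₁ - d₀ - d₂) * ((d₂ : ℝ) - e) * ((e : ℝ) - d₁) * ((d₂ : ℝ) - d₁) * ((d₃ : ℝ) - e) * ((d₂ : ℝ) + d₃ - e - d₁)
      = (3 * x₂ + x₃ + x₄ + x₅) * (3 * x₂ + x₃) * (x₄ + x₅) * (x₂ + x₄ + x₅) * (x₂ + 2 * x₄ + 2 * x₅) * (4 * x₂ + x₃ + 3 * x₄ + 2 * x₅) * (5 * x₂ + x₃ + 5 * x₄ + 4 * x₅) := by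
    rw [hx₂, hx₃, hx₄, hx₅]; ring
  have eC : ((d₃ : ℝ) - e) * ((d₃ : ℝ) - d₂) * ((d₀ : ℝ) + d₃ - d₁ - d₂) * ((d₀ : ℝ) + d₃ - 2 * e) * ((e : ℝ) + d₂ - d₀ - d₃) * ((d₁ : ℝ) - d₀) * ((d₂ : ℝ) - d₀)
      = (4 * x₂ + x₃ + 3 * x₄ + 2 * x₅) * (4 * x₂ + x₃ + 2 * x₄ + x₅) * (x₂ + x₄) * (x₄) * (x₅) * (3 * x₂ + x₃ + x₄ + x₅) * (4 * x₂ + x₃ + 3 * x₄ + 3 * x₅) := by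
    rw [hx₂, hx₃, hx₄, hx₅]; ring
  have eD : ((e : ℝ) + d₃ - e - d₀) * ((d₃ : ℝ) - d₂ + e - d₀) * ((d₃ : ℝ) - d₂ + e - d₁) * ((d₃ : ℝ) - e) * ((d₃ : ℝ) - d₂) * ((e : ℝ) - d₁) * ((d₂ : ℝ) - e)
      = (8 * x₂ + 2 * x₃ + 5 * x₄ + 4 * x₅) * (8 * x₂ + 2 * x₃ + 4 * x₄ + 3 * x₅) * (5 * x₂ + x₃ + 3 * x₄ + 2 * x₅) * (4 * x₂ + x₃ + 3 * x₄ + 2 * x₅) * (4 * x₂ + x₃ + 2 * x₄ + x₅) * (x₂ + x₄ + x₅) * (x₄ + x₅) := by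
    rw [hx₂, hx₃, hx₄, hx₅]; ring
  rw [eA, eB, eC, eD]
  refine ⟨?_, by positivity, by positivity⟩
  have key := core_S_I x₂ x₃ x₄ x₅ h₂ h₃ h₄ h₅
  have hQ : (0 : ℝ) ≤ (x₄ + x₅) * (x₂ + x₄ + x₅) * (x₂ + 2 * x₄ + 2 * x₅) * (4 * x₂ + x₃ + 3 * x₄ + 2 * x₅) * (4 * x₂ + x₃ + 2 * x₄ + x₅) * (4 * x₂ + x₃ + 3 * x₄ + 3 * x₅) := by positivity
  calc 500 * ((3 * x₂ + x₃ + x₄ + x₅) * (3 * x₂ + x₃) * (x₄ + x₅) * (x₂ + x₄ + x₅) * (x₂ + 2 * x₄ + 2 * x₅) * (4 * x₂ + x₃ + 3 * x₄ + 2 * x₅) * (5 * x₂ + x₃ + 5 * x₄ + 4 * x₅)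
      * ((4 * x₂ + x₃ + 3 * x₄ + 2 * x₅) * (4 * x₂ + x₃ + 2 * x₄ + x₅) * (x₂ + x₄) * (x₄) * (x₅) * (3 * x₂ + x₃ + x₄ + x₅) * (4 * x₂ + x₃ + 3 * x₄ + 3 * x₅)))
      = (500 * ((3 * x₂ + x₃ + x₄ + x₅) * (3 * x₂ + x₃) * (5 * x₂ + x₃ + 5 * x₄ + 4 * x₅) * (4 * x₂ + x₃ + 3 * x₄ + 2 * x₅) * (x₂ + x₄) * (x₄) * (x₅) * (3 * x₂ + x₃ + x₄ + x₅)))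
        * ((x₄ + x₅) * (x₂ + x₄ + x₅) * (x₂ + 2 * x₄ + 2 * x₅) * (4 * x₂ + x₃ + 3 * x₄ + 2 * x₅) * (4 * x₂ + x₃ + 2 * x₄ + x₅) * (4 * x₂ + x₃ + 3 * x₄ + 3 * x₅)) := by ring
    _ ≤ ((5 * x₂ + x₃ + 3 * x₄ + 3 * x₅) * (5 * x₂ + x₃ + 4 * x₄ + 4 * x₅) * (8 * x₂ + 2 * x₃ + 5 * x₄ + 4 * x₅) * (9 * x₂ + 2 * x₃ + 7 * x₄ + 6 * x₅) * (8 * x₂ + 2 * x₃ + 5 * x₄ + 4 * x₅) * (8 * x₂ + 2 * x₃ + 4 * x₄ + 3 * x₅) * (5 * x₂ + x₃ + 3 * x₄ + 2 * x₅) * (x₂ + x₄ + x₅))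
        * ((x₄ + x₅) * (x₂ + x₄ + x₅) * (x₂ + 2 * x₄ + 2 * x₅) * (4 * x₂ + x₃ + 3 * x₄ + 2 * x₅) * (4 * x₂ + x₃ + 2 * x₄ + x₅) * (4 * x₂ + x₃ + 3 * x₄ + 3 * x₅)) := mul_le_mul_of_nonneg_right key hQ
    _ = (5 * x₂ + x₃ + 3 * x₄ + 3 * x₅) * (x₂ + x₄ + x₅) * (5 * x₂ + x₃ + 4 * x₄ + 4 * x₅) * (x₂ + 2 * x₄ + 2 * x₅) * (4 * x₂ + x₃ + 3 * x₄ + 3 * x₅) * (8 * x₂ + 2 * x₃ + 5 * x₄ + 4 * x₅) * (9 * x₂ + 2 * x₃ + 7 * x₄ + 6 * x₅)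
      * ((8 * x₂ + 2 * x₃ + 5 * x₄ + 4 * x₅) * (8 * x₂ + 2 * x₃ + 4 * x₄ + 3 * x₅) * (5 * x₂ + x₃ + 3 * x₄ + 2 * x₅) * (4 * x₂ + x₃ + 3 * x₄ + 2 * x₅) * (4 * x₂ + x₃ + 2 * x₄ + x₅) * (x₂ + x₄ + x₅) * (x₄ + x₅)) := by ac_rfl

end Summit.ValiantsHypothesis.ValiantsHypothesis.Theorems.LacunarySymmetroidMatrixDescartes.Pivot.RankOneCover
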